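import Literature.Analysis.Complex.VitaliConvergence
import Mathlib.Analysis.Complex.Convex
import HarnessLib

/-!
# Convergence of holomorphic functions of several variables from convergence at the real points

Topic `Literature/Analysis/Complex`; support file (all proved; no named facts), the several-variable
consequence of Vitali's convergence theorem (`VitaliConvergence`) used for the joint continuity of
the analytically continued Schwinger functions in their spatial parameters (Osterwalder–Schrader
II, Ch. V.2 p. 294: "continuity in the remaining variables"): on the product of right half-planes
`ℂ₊ᵏ`, a sequence of holomorphic functions `F_m`, bounded uniformly in `m` on the compact subsets,
which converges to a holomorphic `f` at the positive real points *with moving arguments*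
(`F_m(ρ_m) → f(ρ)` whenever `ρ_m → ρ`), converges to `f` with moving arguments everywhere:
`F_m(Z_m) → f(Z)` whenever `Z_m → Z` in `ℂ₊ᵏ` — by induction on the number of complex coordinates,
Vitali's theorem in one variable at a time (the positive reals being a set of uniqueness).

* `tendsto_of_tendsto_ofReal` — the statement above.

## References

* E. C. Titchmarsh, *The Theory of Functions*, 2nd ed. (1939), §5.21 (Vitali). [folklore]
* K. Osterwalder, R. Schrader, *Axioms for Euclidean Green's functions II*, Comm. Math. Phys.
  42 (1975) 281–305, Ch. V.2 p. 294. [OsterwalderSchraderCMP1975]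
-/

noncomputable section

open Metric Set Filter Function
open _root_.Topology

namespace Literature.Analysis.Complex

variable {k : ℕ}

/-- The coordinates from `j` on are real. [folklore] -/
def RealFrom (j : ℕ) (Z : Fin k → ℂ) : Prop := ∀ i : Fin k, j ≤ (i : ℕ) → (Z i).im = 0

/-- All coordinates real: the point is `ofReal ∘ re`. [folklore] -/
theorem eq_ofReal_of_realFrom_zero {Z : Fin k → ℂ} (h : RealFrom 0 Z) : Z = fun i => ((Z i).re : ℂ) :=
  funext fun i => Complex.ext (by simp) (by simp [h i (Nat.zero_le _)])

/-- `RealFrom k` is vacuous. [folklore] -/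
theorem realFrom_self (Z : Fin k → ℂ) : RealFrom k Z := fun i hi => absurd i.2 (not_lt.2 hi)

/-- The positive reals accumulate at `1` in `ℂ`. [folklore] -/
theorem frequently_real_pos_nhdsWithin_one {P : ℂ → Prop} (h : ∀ w : ℝ, 0 < w → P (w : ℂ)) :
    ∃ᶠ w in 𝓝[≠] (1 : ℂ), P w := by
  have hu : Tendsto (fun n : ℕ => (((1 : ℝ) + 1 / ((n : ℝ) + 2) : ℝ) : ℂ)) atTop (𝓝[≠] (1 : ℂ)) := by
    refine tendsto_nhdsWithin_iff.2 ⟨?_, Eventually.of_forall fun n => ?_⟩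
    · have h1 : Tendsto (fun n : ℕ => (1 : ℝ) + 1 / ((n : ℝ) + 2)) atTop (𝓝 (1 + 0)) :=
        tendsto_const_nhds.add (tendsto_const_nhds.div_atTop
          (tendsto_atTop_add_const_right _ _ tendsto_natCast_atTop_atTop))
      rw [add_zero] at h1
      have h2 := (Complex.continuous_ofReal.tendsto _).comp h1
      rwa [Complex.ofReal_one] at h2
    · have hn : (0 : ℝ) < 1 / ((n : ℝ) + 2) := by positivity
      rw [mem_compl_iff, mem_singleton_iff, Complex.ofReal_eq_one]
      intro h
      linarith
  exact hu.frequently (Frequently.of_forall fun n => h _ (by positivity))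

/-- **Convergence with moving arguments from convergence at the real points** (several-variable
Vitali on `ℂ₊ᵏ`): see the module docstring. [folklore] -/
theorem tendsto_of_tendsto_ofReal {F : ℕ → (Fin k → ℂ) → ℂ} {f : (Fin k → ℂ) → ℂ}
    (hF : ∀ m, DifferentiableOn ℂ (F m) {Z | ∀ i, 0 < (Z i).re})
    (hf : DifferentiableOn ℂ f {Z | ∀ i, 0 < (Z i).re})
    (hb : ∀ K ⊆ {Z : Fin k → ℂ | ∀ i, 0 < (Z i).re}, IsCompact K → ∃ M : ℝ, ∀ m, ∀ W ∈ K, ‖F m W‖ ≤ M)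
    (h0 : ∀ (ρs : ℕ → Fin k → ℝ) (ρ : Fin k → ℝ), (∀ m i, 0 < ρs m i) → (∀ i, 0 < ρ i) →
      Tendsto ρs atTop (𝓝 ρ) →
        Tendsto (fun m => F m fun i => (ρs m i : ℂ)) atTop (𝓝 (f fun i => (ρ i : ℂ))))
    {Zs : ℕ → Fin k → ℂ} {Z : Fin k → ℂ} (hZs : ∀ m i, 0 < (Zs m i).re) (hZ : ∀ i, 0 < (Z i).re)
    (hlim : Tendsto Zs atTop (𝓝 Z)) : Tendsto (fun m => F m (Zs m)) atTop (𝓝 (f Z)) := by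
  -- induction on the number of complex coordinates
  suffices H : ∀ (j : ℕ) (Zs : ℕ → Fin k → ℂ) (Z : Fin k → ℂ), (∀ m i, 0 < (Zs m i).re) → (∀ i, 0 < (Z i).re) →
      (∀ m, RealFrom j (Zs m)) → RealFrom j Z → Tendsto Zs atTop (𝓝 Z) →
        Tendsto (fun m => F m (Zs m)) atTop (𝓝 (f Z)) from
    H k Zs Z hZs hZ (fun m => realFrom_self _) (realFrom_self _) hlim
  intro j
  induction j with
  | zero =>
    intro Zs Z hZs hZ hrs hr hlim
    have h1 : ∀ m, Zs m = fun i => (((Zs m i).re : ℝ) : ℂ) := fun m => eq_ofReal_of_realFrom_zero (hrs m)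
    have h2 : Z = fun i => (((Z i).re : ℝ) : ℂ) := eq_ofReal_of_realFrom_zero hr
    have hρ : Tendsto (fun m i => (Zs m i).re) atTop (𝓝 fun i => (Z i).re) :=
      (continuous_pi fun i => Complex.continuous_re.comp (continuous_apply i)).tendsto Z |>.comp hlim
    have h := h0 (fun m i => (Zs m i).re) (fun i => (Z i).re) hZs hZ hρ
    rw [h2]
    refine h.congr fun m => ?_
    rw [← h1 m]
  | succ j ih =>
    intro Zs Z hZs hZ hrs hr hlim
    by_cases hjk : j < k
    swap
    · -- no coordinate `j`: the hypotheses coincide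
      exact ih Zs Z hZs hZ (fun m i hi => absurd i.2 (by omega)) (fun i hi => absurd i.2 (by omega)) hlim
    set J : Fin k := ⟨j, hjk⟩ with hJ
    -- the slices in the coordinate `J`
    set U : Set ℂ := {w | 0 < w.re} with hU
    have hUo : IsOpen U := isOpen_lt continuous_const Complex.continuous_re
    have hUc : IsPreconnected U := (convex_halfSpace_re_gt (r := (0 : ℝ))).isPreconnected
    set G : ℕ → ℂ → ℂ := fun m w => F m (update (Zs m) J w) with hG
    set g : ℂ → ℂ := fun w => f (update Z J w) with hg
    have hupd_mem : ∀ {X : Fin k → ℂ}, (∀ i, 0 < (X i).re) → ∀ w ∈ U, update X J w ∈ {Z : Fin k → ℂ | ∀ i, 0 < (Z i).re} := by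
      intro X hX w hw i
      by_cases hi : i = J
      · subst hi; simpa [hU] using hw
      · rw [update_of_ne hi]; exact hX i
    have hupd_diff : ∀ X : Fin k → ℂ, Differentiable ℂ fun w : ℂ => update X J w := fun X =>
      differentiable_pi.2 fun i => by
        by_cases hi : i = J
        · subst hi; simp only [update_self]; exact differentiable_id
        · simp only [update_of_ne hi]; exact differentiable_const _
    have hGd : ∀ m, DifferentiableOn ℂ (G m) U := fun m =>
      (hF m).comp (hupd_diff _).differentiableOn fun w hw => hupd_mem (hZs m) w hw
    have hgd : DifferentiableOn ℂ g U := hf.comp (hupd_diff _).differentiableOn fun w hw => hupd_mem hZ w hw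
    -- pointwise convergence of the slices at the real points, with the induction hypothesis
    have hreal : ∀ w : ℝ, 0 < w → Tendsto (fun m => G m w) atTop (𝓝 (g w)) := by
      intro w hw
      have hwU : (w : ℂ) ∈ U := by simpa [hU] using hw
      refine ih (fun m => update (Zs m) J w) (update Z J w) (fun m => hupd_mem (hZs m) w hwU)
        (hupd_mem hZ w hwU) (fun m i hi => ?_) (fun i hi => ?_) ?_
      · by_cases hiJ : i = J
        · subst hiJ; simp
        · rw [update_of_ne hiJ]; exact hrs m i (by have : (i : ℕ) ≠ j := fun h => hiJ (Fin.ext h); omega)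
      · by_cases hiJ : i = J
        · subst hiJ; simp
        · rw [update_of_ne hiJ]; exact hr i (by have : (i : ℕ) ≠ j := fun h => hiJ (Fin.ext h); omega)
      · exact ((continuous_id.update J continuous_const).tendsto Z).comp hlim
    -- local bounds of the slices, uniformly in `m`, from the compact-set bounds
    have hGb : ∀ a ∈ U, ∃ M : ℝ, ∃ r > 0, ∀ m, ∀ w ∈ ball a r ∩ U, ‖G m w‖ ≤ M := by
      intro a ha
      have ha' : 0 < a.re := ha
      set r : ℝ := a.re / 2 with hr
      have hr0 : 0 < r := by positivity
      set K : Set (Fin k → ℂ) := Set.pi univ fun i => if i = J then closedBall a r else insert (Z i) (range fun m => Zs m i)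
        with hK
      have hKc : IsCompact K := isCompact_univ_pi fun i => by
        by_cases hi : i = J
        · simp only [hi, if_true]; exact isCompact_closedBall _ _
        · simp only [hi, if_false]
          exact (((continuous_apply i).tendsto Z).comp hlim).isCompact_insert_range
      have hKsub : K ⊆ {Z : Fin k → ℂ | ∀ i, 0 < (Z i).re} := by
        intro W hW i
        have hWi := hW i (mem_univ i)
        by_cases hi : i = J
        · simp only [hi, if_true, mem_closedBall] at hWi
          have h1 : |(W J).re - a.re| ≤ dist (W J) a := by
            rw [dist_eq_norm]
            simpa [Complex.sub_re] using Complex.abs_re_le_norm (W J - a)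
          rw [hi]
          have h2 := (abs_le.1 (h1.trans hWi)).1
          linarith
        · simp only [hi, if_false, mem_insert_iff, mem_range] at hWi
          rcases hWi with h | ⟨m, hm⟩
          · rw [h]; exact hZ i
          · rw [← hm]; exact hZs m i
      obtain ⟨M, hM⟩ := hb K hKsub hKc
      refine ⟨M, r, hr0, fun m w hw => hM m _ fun i _ => ?_⟩
      by_cases hi : i = J
      · subst hi; simp only [if_true, update_self]; exact ball_subset_closedBall hw.1
      · simp only [hi, if_false, update_of_ne hi]; exact mem_insert_of_mem _ (mem_range_self m)
    -- Vitali in the coordinate `J`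
    have hfreq : ∃ᶠ w in 𝓝[≠] (1 : ℂ), ∃ c : ℂ, Tendsto (fun m => G m w) atTop (𝓝 c) :=
      frequently_real_pos_nhdsWithin_one fun w hw => ⟨g w, hreal w hw⟩
    have h1U : (1 : ℂ) ∈ U := by simp [hU]
    obtain ⟨g', hg'd, hconv⟩ := exists_tendstoLocallyUniformlyOn_of_frequently_tendsto hUo hUc hGd hGb h1U hfreq
    -- the limit is the slice of `f`
    have hgg' : EqOn g' g U := by
      have hfr : ∃ᶠ w in 𝓝[≠] (1 : ℂ), g' w = g w :=
        frequently_real_pos_nhdsWithin_one fun w hw =>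
          tendsto_nhds_unique (hconv.tendsto_at (by simpa [hU] using hw)) (hreal w hw)
      exact (hg'd.analyticOnNhd hUo).eqOn_of_preconnected_of_frequently_eq (hgd.analyticOnNhd hUo) hUc h1U hfr
    -- convergence with the moving coordinate `J`
    have hZJ : Z J ∈ U := hZ J
    have hlimJ : Tendsto (fun m => Zs m J) atTop (𝓝[U] (Z J)) :=
      tendsto_nhdsWithin_iff.2 ⟨((continuous_apply J).tendsto Z).comp hlim, Eventually.of_forall fun m => hZs m J⟩
    have h := hconv.tendsto_comp (hg'd.continuousOn.continuousWithinAt hZJ) hZJ hlimJ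
    rw [hgg' hZJ] at h
    have h3 : ∀ m, G m (Zs m J) = F m (Zs m) := fun m => by simp [hG]
    have h4 : g (Z J) = f Z := by simp [hg]
    rw [h4] at h
    exact h.congr fun m => h3 m

end Literature.Analysis.Complex
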